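import Summits.Ventures.PercRepro.C041TriDomTwoPayerSplit

/-!
# ROW C-041 — THE PAYERS OF THE x-SPLIT: the red-only cyclic count minus a correction `E`, and the blue-only count
plus `E` (p6, gen 49; P6-TWOEXIT-LEAN.md §53 ADDENDUM 23)

On the four-mark patterns `(xy, xz, xq, yz, yq, zq)` of `(x, y, z, q)` let `CycR s t = CycF (xjoin3 s) (proj3 t)` be
the cyclic functional with `x` and `q` merged in red only (the class of the colouring with the split edge red) and
`CycB s t = CycF (proj3 s) (xjoin3 t)` the one with `x, q` merged in blue only.  The correction `E` is the indicator
of twelve pairs of partitions (`corrE`, by their binary encodings `enc6`):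
`(xy|zq ; xzq|y)`, `(xy|zq ; xz|y|q)`, `(xy|zq ; xq|y|z)`, `(xy|zq ; x|y|zq)`, `(xy|zq ; x|y|z|q)`,
`(xz|yq ; x|yz|q)`, `(xq|yz ; x|yq|z)`, `(x|yzq ; xyq|z)`, `(x|yzq ; xy|zq)`, `(x|yzq ; xy|z|q)`,
`(x|yzq ; x|yq|z)`, `(x|yz|q ; x|yq|z)`.  The payers are `payerA = CycR − E` and `payerB = CycB + E`; they satisfy
the key inequalities of THEOREM (TWO-PAYER SPLIT) by construction (`payerA_keyP`, `payers_keyVB`: `E ≥ 0` and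
`A + B = CycR + CycB`), so `cycDominationS_of_payersE`: CONJECTURE (STOCHASTIC DOMINATION) holds on every status as
soon as `Σ_V payerA ≥ 0` and `Σ_V payerB ≥ 0` on every up-set of every status for every fourth mark.  Both are
CENSUS-TRUE (0 violations on 170,000 random and 503,660 exhaustive small-host checks, gen 49) and lie outside every
anchored cone; `payerA` restricted to `q = x` is the cyclic functional itself (`E` vanishes there), so `payerA`
generalises the conjecture by a fourth mark.  Proving the two payers is the open core of the lane after gen 49.
-/

namespace PercRepro

namespace ZoneZ

namespace MultiExit

open ZoneData Finset

variable {V₁ E₁ U₁ U₂ : Type} (Z₁ : ZoneData V₁ E₁ U₁ U₂) (u u' a₁ : V₁)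

/-- The cyclic functional with `x` and `q` merged in red only. -/
def CycR (s t : P6) : ℤ := CycF (xjoin3 s) (proj3 t)

/-- The cyclic functional with `x` and `q` merged in blue only. -/
def CycB (s t : P6) : ℤ := CycF (proj3 s) (xjoin3 t)

/-- The twelve pairs of partitions of the correction, by binary encodings `(enc6 s, enc6 t)`. -/
def corrList : List (ℕ × ℕ) :=
  [(33, 25), (33, 16), (33, 8), (33, 1), (33, 0), (18, 4), (12, 2), (7, 42), (7, 33), (7, 32), (7, 2), (4, 2)]

/-- The correction `E`: `1` on the twelve pairs, `0` elsewhere. -/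
def corrE (s t : P6) : ℤ := if (enc6 s, enc6 t) ∈ corrList then 1 else 0

/-- The first payer: the red-only cyclic count minus the correction. -/
def payerA (s t : P6) : ℤ := CycR s t - corrE s t

/-- The second payer: the blue-only cyclic count plus the correction. -/
def payerB (s t : P6) : ℤ := CycB s t + corrE s t

/-- The correction is non-negative. -/
theorem corrE_nonneg (s t : P6) : 0 ≤ corrE s t := by
  unfold corrE; split_ifs <;> decide

/-- The first payer satisfies the key inequality (P). -/
theorem payerA_keyP : PayerKeyP payerA := by
  intro s _ t _
  have := corrE_nonneg s t
  unfold payerA CycR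
  omega

/-- The payers satisfy the key inequality (VB). -/
theorem payers_keyVB : PayerKeyVB payerA payerB := by
  intro s _ t _
  unfold payerA payerB CycR CycB
  omega

/-- The correction vanishes when the fourth mark coincides with the anchor in both colours (on the partitions). -/
theorem corrE_eq_zero_of_xq : ∀ s ∈ valid6, ∀ t ∈ valid6, s.2.2.1 = true → t.2.2.1 = true → corrE s t = 0 := by
  decide

/-- With the fourth mark coincident with the anchor, the first payer is the cyclic functional (on the partitions). -/
theorem payerA_of_xq : ∀ s ∈ valid6, ∀ t ∈ valid6, s.2.2.1 = true → t.2.2.1 = true →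
    payerA s t = CycF (proj3 s) (proj3 t) := by
  decide

variable [DecidableEq E₁] [Fintype E₁]

open Classical in
/-- **CONJECTURE (STOCHASTIC DOMINATION) FROM THE TWO PAYERS**: if `payerA` and `payerB` have non-negative count on
every up-set of every status for every fourth mark, the cyclic orientation holds on every status. -/
theorem cycDominationS_of_payersE
    (hA : ∀ (q : V₁) (st : E₁ → EStat) (V : (E₁ → Bool) → Prop), UpSet V → 0 ≤ cntF6 Z₁ u u' q a₁ payerA st V)
    (hB : ∀ (q : V₁) (st : E₁ → EStat) (V : (E₁ → Bool) → Prop), UpSet V → 0 ≤ cntF6 Z₁ u u' q a₁ payerB st V)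
    (st : E₁ → EStat) : CycDominationS Z₁ a₁ u u' st :=
  cycDominationS_of_payers Z₁ u u' a₁ payerA_keyP payers_keyVB hA hB st

open Classical in
/-- The all-free form. -/
theorem cycDomination_of_payersE
    (hA : ∀ (q : V₁) (st : E₁ → EStat) (V : (E₁ → Bool) → Prop), UpSet V → 0 ≤ cntF6 Z₁ u u' q a₁ payerA st V)
    (hB : ∀ (q : V₁) (st : E₁ → EStat) (V : (E₁ → Bool) → Prop), UpSet V → 0 ≤ cntF6 Z₁ u u' q a₁ payerB st V) :
    CycDomination Z₁ a₁ u u' :=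
  cycDomination_of_payers Z₁ u u' a₁ payerA_keyP payers_keyVB hA hB

end MultiExit

end ZoneZ

end PercRepro
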